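import Mathlib
import HarnessLib
import Literature.Analysis.FluidPDE.Tao2016AveragedNS.LocalCascadeSolutions
import Literature.Analysis.FluidPDE.Tao2016AveragedNS.RenormalisedCascadeWaves
import Literature.Analysis.FluidPDE.Tao2016AveragedNS.SelfSimilarCascadeBlowup
import Literature.Analysis.FluidPDE.Tao2016AveragedNS.ViscousEternalSolutions
import Literature.Analysis.FluidPDE.Tao2016AveragedNS.BoundedEternalSolutions
import Summits.NavierStokesRegularity.NavierStokesRegularity.Theses.TaoLadderRungTwoBreak
import Summits.NavierStokesRegularity.NavierStokesRegularity.Theorems.TaoLadderRungTwoBreakEternalRigidityViscBddOneDefs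
import Summits.NavierStokesRegularity.NavierStokesRegularity.Theorems.TaoLadderRungTwoBreakEternalRigidityViscBddOneStubViscousBlowup

/-!
# Crux `TaoLadderRungTwoBreak.EternalRigidityViscBddOne` (stmt-NavierStokesRegularity-20420): what the two open stubs
# (ω3) `stub_typeOne` / (ω4) `stub_eternalLimitViscBdd` SAY next to the deciding crux K1ᵛ(1) ⟨20419⟩ — stub duality,
# and the eternal-free closer `Target ⟸ viscous regularity below threshold`

MODEL lattice ODEs of Tao 2016 §4 only (the exact NS-scaled `ν`-viscous cascade lattice of a table of `InTableClass R`,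
`m = 4`, from a one-shell datum, in the registered vocabulary `ViscousUpTo` / `BlowsUpAt` / `TypeOne` of the skeleton
`85fbfe8e90eea58b`); nothing here is a statement about the Navier–Stokes equations; no stub, crux or summit is closed
(`--supports stmt-NavierStokesRegularity-20420`).

Two predicates of this file, both with parameters-free bodies over the REGISTERED vocabulary (no new objects):

* «no viscous blow-up below threshold» — for every spread `R ≥ 1` there is `εs > 0` such that for `ε₀ ∈ (0, εs]`, every
  table of `InTableClass R`, every one-shell datum and every `ν > 0`, NO regular trajectory of the exact `ν`-viscous lattice
  blows up (`ViscousUpTo → ¬ BlowsUpAt`);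
* «no TYPE-I viscous blow-up below threshold» — the same with `BlowsUpAt → ¬ TypeOne`.

Results (all by name over registered signatures, quoted VERBATIM as hypotheses):

* `target_of_noViscousBlowupBelow` — **THE ETERNAL-FREE CLOSER**: «no viscous blow-up below threshold» ⟹ the route's
  `Target` DIRECTLY (robust blow-up in κ-normal form `noGlobalCascade_iff_kappa` + the LANDED stub (ω1) `stub_viscousBlowup`
  with `ν = κ/√2` produce a blowing-up regular trajectory — contradiction).  No eternal solution, no K1ᵛ, no (ω3)/(ω4).
* `stub_eternalLimitViscBdd_of_noTypeOneBlowupBelow` — (ω4) holds VACUOUSLY under «no type-I viscous blow-up below threshold»;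
* `noTypeOneBlowupBelow_of_stub_eternalLimitViscBdd` — conversely, GIVEN the deciding crux K1ᵛ(1) `NoSurvivingEternalViscBddOne`
  ⟨20419⟩, (ω4) forces «no type-I viscous blow-up below threshold» (the extracted surviving bounded eternal solution is what K1ᵛ
  forbids); hence `stub_eternalLimitViscBdd_iff_noTypeOneBlowupBelow` — **(ω4) ⟺ «no type-I viscous blow-up below threshold»
  modulo K1ᵛ(1)** (the census remark «(ω4) = Target on type-I blow-ups», kernel-checked);
* `noViscousBlowupBelow_of_stubs` — K1ᵛ(1) ∧ (ω3) ∧ (ω4) ⟹ «no viscous blow-up below threshold» (so, with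
  `target_of_noViscousBlowupBelow`, the route's `closes` factors through viscous regularity);
* `stub_typeOne_and_eternalLimit_of_noViscousBlowupBelow` — conversely «no viscous blow-up below threshold» gives BOTH (ω3) and (ω4)
  vacuously: along the registered line, ⟨20420⟩'s open content is EXACTLY sub-threshold viscous regularity at fixed spread off
  the K1ᵛ wall, and nothing weaker than that closes (ω3).

READING (repair census for ⟨20420⟩, kernel-precise): (ω3)+(ω4) are not two independent analytic lemmas but one dichotomy —
either one proves sub-threshold VISCOUS REGULARITY for fixed spread (then (ω3), (ω4), ⟨20420⟩ AND the Target follow here, and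
⟨20419⟩ is not needed for the Target), or there are sub-threshold viscous blow-ups, and then (ω3) is a type-I RATE theorem and
(ω4) a compactness/extraction theorem whose output K1ᵛ(1) must kill.  HONEST LABEL: bookkeeping over landed theorems; (ω3),
(ω4), ⟨20419⟩, ⟨20420⟩, the Target and every NS statement remain OPEN; rung 0.
-/

noncomputable section

-- the summit and its single sub-problem share the name (CONVENTIONS §1)
set_option linter.dupNamespace false

namespace Summit.NavierStokesRegularity.NavierStokesRegularity.Theorems.EternalRigidityViscBddOne.StubDuality

open Set
open Literature.Analysis.FluidPDE Literature.Analysis.FluidPDE.TaoCascade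
open Summit.NavierStokesRegularity.NavierStokesRegularity.Theses.TaoLadderRungTwoBreak
open Summit.NavierStokesRegularity.NavierStokesRegularity.Theorems.EternalRigidityViscBddOne.Birth

/-! ### §1 The eternal-free closer -/

/-- **`Target ⟸ no viscous blow-up below threshold` (eternal-free).**  If for every spread `R ≥ 1` there is a threshold below
which no regular trajectory of the exact `ν`-viscous NS-scaled lattice (`ν > 0`) of a table of `InTableClass R` from a one-shell
datum blows up, then no such table blows up robustly: the route leaf `Target`.  (Robust blow-up in κ-normal form
`noGlobalCascade_iff_kappa`; the landed stub (ω1) `stub_viscousBlowup` with `ν = κ/√2` supplies a blowing-up regular trajectory.)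
[cite: Tao2016AveragedNS, §4 Thm. 4.2 with Lemma 4.1 (4.5)–(4.11) and the viscous equation before Thm. 4.2; cell composition] -/
theorem target_of_noViscousBlowupBelow
    (hreg : ∀ R : ℝ, 1 ≤ R → ∃ εs : ℝ, 0 < εs ∧ ∀ ε₀ : ℝ, 0 < ε₀ → ε₀ ≤ εs →
      ∀ (α : Fin 4 → Fin 4 → Fin 4 → ℤ × ℤ × ℤ → ℝ) (X₀ : Fin 4 → ℝ), InTableClass R α →
        ∀ ν : ℝ, 0 < ν → ∀ (X : Fin 4 → ℤ → ℝ → ℝ) (tStar : ℝ),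
          ViscousUpTo ε₀ ν α X₀ X tStar → ¬ BlowsUpAt ε₀ X tStar) :
    Target := by
  intro R hR
  obtain ⟨εs, hεs, H⟩ := hreg R hR
  refine ⟨εs, hεs, fun ε₀ hε₀ hle α X₀ hα hNG => ?_⟩
  obtain ⟨κ, hκ, hnot⟩ := (noGlobalCascade_iff_kappa hε₀).1 hNG
  have h2pos : 0 < Real.sqrt 2 := Real.sqrt_pos.2 two_pos
  have hν : 0 < κ / Real.sqrt 2 := div_pos hκ h2pos
  have hνκ : κ / Real.sqrt 2 * Real.sqrt 2 ≤ κ := by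
    rw [div_mul_cancel₀ κ (ne_of_gt h2pos)]
  obtain ⟨X, tStar, hV, hB⟩ := stub_viscousBlowup R hR ε₀ hε₀ α X₀ hα κ (κ / Real.sqrt 2) hν hνκ hnot
  exact H ε₀ hε₀ hle α X₀ hα _ hν X tStar hV hB

/-! ### §2 (ω4) against the deciding crux: stub duality -/

/-- **(ω4) vacuously from «no type-I viscous blow-up below threshold».**  The registered conclusion of `stub_eternalLimitViscBdd`
(signature VERBATIM) holds whenever no sub-threshold regular viscous trajectory of a fixed-spread table blows up at the type-I rate.
[cite: Tao2016AveragedNS, §4 Thm. 4.2 (statement shape), §6.4; cell vocabulary] -/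
theorem stub_eternalLimitViscBdd_of_noTypeOneBlowupBelow
    (hno : ∀ R : ℝ, 1 ≤ R → ∃ εs : ℝ, 0 < εs ∧ ∀ ε₀ : ℝ, 0 < ε₀ → ε₀ ≤ εs →
      ∀ (α : Fin 4 → Fin 4 → Fin 4 → ℤ × ℤ × ℤ → ℝ) (X₀ : Fin 4 → ℝ), InTableClass R α →
        ∀ ν : ℝ, 0 < ν → ∀ (X : Fin 4 → ℤ → ℝ → ℝ) (tStar : ℝ),
          ViscousUpTo ε₀ ν α X₀ X tStar → BlowsUpAt ε₀ X tStar → ¬ TypeOne ε₀ X tStar) :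
    ∀ R : ℝ, 1 ≤ R → ∃ εs : ℝ, 0 < εs ∧ ∀ ε₀ : ℝ, 0 < ε₀ → ε₀ ≤ εs →
      ∀ (α : Fin 4 → Fin 4 → Fin 4 → ℤ × ℤ × ℤ → ℝ) (X₀ : Fin 4 → ℝ), InTableClass R α →
        ∀ ν : ℝ, 0 < ν → ∀ (X : Fin 4 → ℤ → ℝ → ℝ) (tStar : ℝ),
          ViscousUpTo ε₀ ν α X₀ X tStar → BlowsUpAt ε₀ X tStar → TypeOne ε₀ X tStar →
            ∃ (νh : ℝ) (W : ℤ → ℝ → Em 4), IsEternalVisc ε₀ νh α W ∧ UniformBound W ∧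
              EternalSurvivingFwd 1 ε₀ W := by
  intro R hR
  obtain ⟨εs, hεs, H⟩ := hno R hR
  exact ⟨εs, hεs, fun ε₀ hε₀ hle α X₀ hα ν hν X tStar hV hB hT =>
    absurd hT (H ε₀ hε₀ hle α X₀ hα ν hν X tStar hV hB)⟩

/-- **Given K1ᵛ(1), (ω4) forces «no type-I viscous blow-up below threshold».**  With the deciding crux
`NoSurvivingEternalViscBddOne` ⟨20419⟩ as a hypothesis, the registered stub (ω4) `stub_eternalLimitViscBdd` (signature VERBATIM)
implies that below `min` of the two thresholds no regular viscous trajectory of a table of `InTableClass R` from a one-shell datum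
blows up at the type-I rate: the extracted uniformly bounded forward-(S₁)-surviving admissible eternal solution is exactly what
K1ᵛ(1) forbids.
[cite: Tao2016AveragedNS, §4 Thm. 4.2 (statement shape), §6.4; cell composition] -/
theorem noTypeOneBlowupBelow_of_stub_eternalLimitViscBdd (hK : NoSurvivingEternalViscBddOne)
    (h4 : ∀ R : ℝ, 1 ≤ R → ∃ εs : ℝ, 0 < εs ∧ ∀ ε₀ : ℝ, 0 < ε₀ → ε₀ ≤ εs →
      ∀ (α : Fin 4 → Fin 4 → Fin 4 → ℤ × ℤ × ℤ → ℝ) (X₀ : Fin 4 → ℝ), InTableClass R α →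
        ∀ ν : ℝ, 0 < ν → ∀ (X : Fin 4 → ℤ → ℝ → ℝ) (tStar : ℝ),
          ViscousUpTo ε₀ ν α X₀ X tStar → BlowsUpAt ε₀ X tStar → TypeOne ε₀ X tStar →
            ∃ (νh : ℝ) (W : ℤ → ℝ → Em 4), IsEternalVisc ε₀ νh α W ∧ UniformBound W ∧
              EternalSurvivingFwd 1 ε₀ W) :
    ∀ R : ℝ, 1 ≤ R → ∃ εs : ℝ, 0 < εs ∧ ∀ ε₀ : ℝ, 0 < ε₀ → ε₀ ≤ εs →
      ∀ (α : Fin 4 → Fin 4 → Fin 4 → ℤ × ℤ × ℤ → ℝ) (X₀ : Fin 4 → ℝ), InTableClass R α →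
        ∀ ν : ℝ, 0 < ν → ∀ (X : Fin 4 → ℤ → ℝ → ℝ) (tStar : ℝ),
          ViscousUpTo ε₀ ν α X₀ X tStar → BlowsUpAt ε₀ X tStar → ¬ TypeOne ε₀ X tStar := by
  intro R hR
  obtain ⟨εK, hεK, HK⟩ := hK R hR
  obtain ⟨ε₄, hε₄, H4⟩ := h4 R hR
  refine ⟨min εK ε₄, lt_min hεK hε₄, ?_⟩
  intro ε₀ hε₀ hle α X₀ hα ν hν X tStar hV hB hT
  have hleK : ε₀ ≤ εK := hle.trans (min_le_left _ _)
  have hle₄ : ε₀ ≤ ε₄ := hle.trans (min_le_right _ _)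
  obtain ⟨νh, W, hW, hU, hS⟩ := H4 ε₀ hε₀ hle₄ α X₀ hα ν hν X tStar hV hB hT
  exact HK ε₀ hε₀ hleK α hα νh W hW hU hS

/-- **Stub duality for (ω4).**  Modulo the deciding crux K1ᵛ(1) ⟨20419⟩, the registered stub (ω4) `stub_eternalLimitViscBdd` of
⟨20420⟩ is EQUIVALENT to «no type-I viscous blow-up below threshold at fixed spread» (the census reading «(ω4) = the Target on
type-I blow-ups», by name).
[cite: Tao2016AveragedNS, §4 Thm. 4.2 (statement shape), §6.4; cell composition] -/
theorem stub_eternalLimitViscBdd_iff_noTypeOneBlowupBelow (hK : NoSurvivingEternalViscBddOne) :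
    (∀ R : ℝ, 1 ≤ R → ∃ εs : ℝ, 0 < εs ∧ ∀ ε₀ : ℝ, 0 < ε₀ → ε₀ ≤ εs →
      ∀ (α : Fin 4 → Fin 4 → Fin 4 → ℤ × ℤ × ℤ → ℝ) (X₀ : Fin 4 → ℝ), InTableClass R α →
        ∀ ν : ℝ, 0 < ν → ∀ (X : Fin 4 → ℤ → ℝ → ℝ) (tStar : ℝ),
          ViscousUpTo ε₀ ν α X₀ X tStar → BlowsUpAt ε₀ X tStar → TypeOne ε₀ X tStar →
            ∃ (νh : ℝ) (W : ℤ → ℝ → Em 4), IsEternalVisc ε₀ νh α W ∧ UniformBound W ∧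
              EternalSurvivingFwd 1 ε₀ W) ↔
    (∀ R : ℝ, 1 ≤ R → ∃ εs : ℝ, 0 < εs ∧ ∀ ε₀ : ℝ, 0 < ε₀ → ε₀ ≤ εs →
      ∀ (α : Fin 4 → Fin 4 → Fin 4 → ℤ × ℤ × ℤ → ℝ) (X₀ : Fin 4 → ℝ), InTableClass R α →
        ∀ ν : ℝ, 0 < ν → ∀ (X : Fin 4 → ℤ → ℝ → ℝ) (tStar : ℝ),
          ViscousUpTo ε₀ ν α X₀ X tStar → BlowsUpAt ε₀ X tStar → ¬ TypeOne ε₀ X tStar) :=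
  ⟨noTypeOneBlowupBelow_of_stub_eternalLimitViscBdd hK, stub_eternalLimitViscBdd_of_noTypeOneBlowupBelow⟩

/-! ### §3 Both stubs together: sub-threshold viscous regularity -/

/-- **K1ᵛ(1) ∧ (ω3) ∧ (ω4) ⟹ «no viscous blow-up below threshold».**  With the deciding crux ⟨20419⟩ and the two registered open
stubs of ⟨20420⟩ (signatures VERBATIM), below `min` of the three thresholds no regular trajectory of the exact `ν`-viscous lattice
(`ν > 0`) of a table of `InTableClass R` from a one-shell datum blows up at all ((ω3) makes every blow-up type I; §2 excludes those).
With `target_of_noViscousBlowupBelow` this re-derives the route's `closes` through viscous regularity.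
[cite: Tao2016AveragedNS, §4 Thm. 4.2 (statement shape), §6.4; cell composition] -/
theorem noViscousBlowupBelow_of_stubs (hK : NoSurvivingEternalViscBddOne)
    (h3 : ∀ R : ℝ, 1 ≤ R → ∃ εs : ℝ, 0 < εs ∧ ∀ ε₀ : ℝ, 0 < ε₀ → ε₀ ≤ εs →
      ∀ (α : Fin 4 → Fin 4 → Fin 4 → ℤ × ℤ × ℤ → ℝ) (X₀ : Fin 4 → ℝ), InTableClass R α →
        ∀ ν : ℝ, 0 < ν → ∀ (X : Fin 4 → ℤ → ℝ → ℝ) (tStar : ℝ),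
          ViscousUpTo ε₀ ν α X₀ X tStar → BlowsUpAt ε₀ X tStar → TypeOne ε₀ X tStar)
    (h4 : ∀ R : ℝ, 1 ≤ R → ∃ εs : ℝ, 0 < εs ∧ ∀ ε₀ : ℝ, 0 < ε₀ → ε₀ ≤ εs →
      ∀ (α : Fin 4 → Fin 4 → Fin 4 → ℤ × ℤ × ℤ → ℝ) (X₀ : Fin 4 → ℝ), InTableClass R α →
        ∀ ν : ℝ, 0 < ν → ∀ (X : Fin 4 → ℤ → ℝ → ℝ) (tStar : ℝ),
          ViscousUpTo ε₀ ν α X₀ X tStar → BlowsUpAt ε₀ X tStar → TypeOne ε₀ X tStar →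
            ∃ (νh : ℝ) (W : ℤ → ℝ → Em 4), IsEternalVisc ε₀ νh α W ∧ UniformBound W ∧
              EternalSurvivingFwd 1 ε₀ W) :
    ∀ R : ℝ, 1 ≤ R → ∃ εs : ℝ, 0 < εs ∧ ∀ ε₀ : ℝ, 0 < ε₀ → ε₀ ≤ εs →
      ∀ (α : Fin 4 → Fin 4 → Fin 4 → ℤ × ℤ × ℤ → ℝ) (X₀ : Fin 4 → ℝ), InTableClass R α →
        ∀ ν : ℝ, 0 < ν → ∀ (X : Fin 4 → ℤ → ℝ → ℝ) (tStar : ℝ),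
          ViscousUpTo ε₀ ν α X₀ X tStar → ¬ BlowsUpAt ε₀ X tStar := by
  intro R hR
  obtain ⟨ε₃, hε₃, H3⟩ := h3 R hR
  obtain ⟨εN, hεN, HN⟩ := noTypeOneBlowupBelow_of_stub_eternalLimitViscBdd hK h4 R hR
  refine ⟨min ε₃ εN, lt_min hε₃ hεN, ?_⟩
  intro ε₀ hε₀ hle α X₀ hα ν hν X tStar hV hB
  have hle₃ : ε₀ ≤ ε₃ := hle.trans (min_le_left _ _)
  have hleN : ε₀ ≤ εN := hle.trans (min_le_right _ _)
  exact HN ε₀ hε₀ hleN α X₀ hα ν hν X tStar hV hB (H3 ε₀ hε₀ hle₃ α X₀ hα ν hν X tStar hV hB)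

/-- **Conversely, «no viscous blow-up below threshold» gives BOTH open stubs of ⟨20420⟩ vacuously** — the registered conclusions
of (ω3) `stub_typeOne` and (ω4) `stub_eternalLimitViscBdd`, in the binder order of the skeleton `85fbfe8e90eea58b`, with ONE
threshold.  So along the registered line the open content of ⟨20420⟩ off the K1ᵛ wall is exactly sub-threshold viscous regularity
at fixed spread (which already closes the `Target` by `target_of_noViscousBlowupBelow`).
[cite: Tao2016AveragedNS, §4 Thm. 4.2 (statement shape), §6.4; cell composition] -/
theorem stub_typeOne_and_eternalLimit_of_noViscousBlowupBelow
    (hreg : ∀ R : ℝ, 1 ≤ R → ∃ εs : ℝ, 0 < εs ∧ ∀ ε₀ : ℝ, 0 < ε₀ → ε₀ ≤ εs →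
      ∀ (α : Fin 4 → Fin 4 → Fin 4 → ℤ × ℤ × ℤ → ℝ) (X₀ : Fin 4 → ℝ), InTableClass R α →
        ∀ ν : ℝ, 0 < ν → ∀ (X : Fin 4 → ℤ → ℝ → ℝ) (tStar : ℝ),
          ViscousUpTo ε₀ ν α X₀ X tStar → ¬ BlowsUpAt ε₀ X tStar) :
    ∀ R : ℝ, 1 ≤ R → ∃ εs : ℝ, 0 < εs ∧ ∀ ε₀ : ℝ, 0 < ε₀ → ε₀ ≤ εs →
      ∀ (α : Fin 4 → Fin 4 → Fin 4 → ℤ × ℤ × ℤ → ℝ) (X₀ : Fin 4 → ℝ), InTableClass R α →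
        ∀ ν : ℝ, 0 < ν → ∀ (X : Fin 4 → ℤ → ℝ → ℝ) (tStar : ℝ),
          ViscousUpTo ε₀ ν α X₀ X tStar → BlowsUpAt ε₀ X tStar →
            TypeOne ε₀ X tStar ∧
              ∃ (νh : ℝ) (W : ℤ → ℝ → Em 4), IsEternalVisc ε₀ νh α W ∧ UniformBound W ∧
                EternalSurvivingFwd 1 ε₀ W := by
  intro R hR
  obtain ⟨εs, hεs, H⟩ := hreg R hR
  exact ⟨εs, hεs, fun ε₀ hε₀ hle α X₀ hα ν hν X tStar hV hB =>
    absurd hB (H ε₀ hε₀ hle α X₀ hα ν hν X tStar hV)⟩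

/-- **The crux ⟨20420⟩ itself from «no viscous blow-up below threshold»** (vacuously, through
`target_of_noViscousBlowupBelow`: below the Target's threshold there is no robust blow-up to extract from; compare the tree's
`eternalRigidityViscBddOne_of_target`).
[cite: Tao2016AveragedNS, §4 Thm. 4.2 (statement shape), §6.4; cell composition] -/
theorem eternalRigidityViscBddOne_of_noViscousBlowupBelow
    (hreg : ∀ R : ℝ, 1 ≤ R → ∃ εs : ℝ, 0 < εs ∧ ∀ ε₀ : ℝ, 0 < ε₀ → ε₀ ≤ εs →
      ∀ (α : Fin 4 → Fin 4 → Fin 4 → ℤ × ℤ × ℤ → ℝ) (X₀ : Fin 4 → ℝ), InTableClass R α →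
        ∀ ν : ℝ, 0 < ν → ∀ (X : Fin 4 → ℤ → ℝ → ℝ) (tStar : ℝ),
          ViscousUpTo ε₀ ν α X₀ X tStar → ¬ BlowsUpAt ε₀ X tStar) :
    EternalRigidityViscBddOne := by
  have hT : Target := target_of_noViscousBlowupBelow hreg
  intro R hR
  obtain ⟨εR, hεR, H⟩ := hT R hR
  exact ⟨εR, hεR, fun ε₀ hε₀ hle α X₀ hα hNG => absurd hNG (H ε₀ hε₀ hle α X₀ hα)⟩

end Summit.NavierStokesRegularity.NavierStokesRegularity.Theorems.EternalRigidityViscBddOne.StubDuality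

end
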